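import Mathlib
import Summits.MatrixMultiplication.MatrixMultiplication.Theorems.SubgroupIdentityDesigns.Negative.LevelCount

/-!
# The level–field law for witnesses of `SubgroupIdentityDesigns`
# (support lemma for stmt-MatrixMultiplication-14079; cell B2b-5 `b2b-lgcu-borel`, gen 11 —
# report `run/shared/lean/b2b/levelgraded-cu/ORACLE-g11.md` §G11-5b)

Quotable forms of `LevelCount.no_witness_small_eps'`:

* `witness_law` — **every witness of the crux at `ε` (level `k`, host `GL_m(𝔽_p)`, any `m`) satisfies
  `log 2 / (6ε) < k² · log p`.**
* `no_fixed_level_field` — for every prime `p` and level `k` there is an explicit `ε₀ > 0` such that NO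
  `GL_m(𝔽_p)`, `m` arbitrary, hosts a level-`k` witness at any `ε ≤ ε₀`.

So the crux (which asks for witnesses at every `ε > 0`) cannot be met inside any fixed (field, level)
pair — the graded sharpening of `crux_no_fixed_host`.  Sorry-free; standard axioms.
VALUE = theorem (structural constraint), NOT summit progress.
-/

set_option linter.dupNamespace false

open scoped BigOperators Classical Matrix

namespace Summit.MatrixMultiplication.MatrixMultiplication.Theorems.SubgroupIdentityDesigns.Negative
namespace LevelCountLaw

open Literature.RepresentationTheory.FiniteGroups
open Literature.Barriers.MatrixMultiplication (SubgroupTPP)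
open Summit.MatrixMultiplication.MatrixMultiplication.Theorems.LieRankDesigns.Negative
open LevelCount (no_witness_small_eps')

variable {p : ℕ} [hp : Fact p.Prime] {m : ℕ}

/-- **THE LEVEL–FIELD LAW**: a level-`k` witness of the crux in `GL_m(𝔽_p)` at exponent `ε` forces
`log 2 / (6 ε) < k² log p` (any `m`). -/
theorem witness_law {k : ℕ} {ε : ℝ} (hε : 0 < ε)
    {H₁ H₂ H₃ : Subgroup (GLm p m)} (htpp : SubgroupTPP H₁ H₂ H₃)
    (hdes : ∃ c : Mat p m → ℂ, (∀ M, k < M.rank → c M = 0) ∧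
      (∑ M, c M * ZMod.stdAddChar (Matrix.trace (M * ((1 : GLm p m) : Mat p m)))) = 1 ∧
      ∀ a ∈ H₁, ∀ b ∈ H₂, ∀ g ∈ H₃, a * b * g ≠ 1 →
        (∑ M, c M * ZMod.stdAddChar
          (Matrix.trace (M * ((a * b * g : GLm p m) : Mat p m)))) = 0)
    (hlt : budget p m k (2 + ε) <
      ((Nat.card H₁ * Nat.card H₂ * Nat.card H₃ : ℕ) : ℝ) ^ ((2 + ε) / 3)) :
    Real.log 2 / (6 * ε) < (k : ℝ) ^ 2 * Real.log p := by
  by_contra hle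
  push Not at hle
  refine no_witness_small_eps' hε ?_ htpp hdes hlt
  have hpR : (0 : ℝ) < p := by exact_mod_cast hp.out.pos
  have hlog2 : 0 < Real.log 2 := Real.log_pos one_lt_two
  have hlogp : 0 ≤ Real.log p := Real.log_nonneg (by exact_mod_cast hp.out.one_lt.le)
  rw [← Real.log_le_log_iff (Real.rpow_pos_of_pos hpR _) (Real.rpow_pos_of_pos two_pos _),
    Real.log_rpow hpR, Real.log_rpow two_pos]
  push_cast
  have h1 : (k : ℝ) ^ 2 * Real.log p * (6 * ε) ≤ Real.log 2 := by
    have := mul_le_mul_of_nonneg_right hle (by linarith : (0 : ℝ) ≤ 6 * ε)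
    rwa [div_mul_cancel₀ _ (by linarith : (6 : ℝ) * ε ≠ 0)] at this
  nlinarith [h1, hlog2, hε, hlogp]

/-- **NO FIXED (FIELD, LEVEL) PAIR SERVES THE CRUX**: for every prime `p` and level `k` there is
`ε₀ > 0` (namely `log 2 / (6 (k² log p + 1))`) below which no `GL_m(𝔽_p)`, `m` arbitrary, hosts a
level-`k` witness. -/
theorem no_fixed_level_field (k : ℕ) :
    ∃ ε₀ : ℝ, 0 < ε₀ ∧ ∀ ε : ℝ, 0 < ε → ε ≤ ε₀ → ∀ (m : ℕ) (H₁ H₂ H₃ : Subgroup (GLm p m)),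
      SubgroupTPP H₁ H₂ H₃ →
      (∃ c : Mat p m → ℂ, (∀ M, k < M.rank → c M = 0) ∧
        (∑ M, c M * ZMod.stdAddChar (Matrix.trace (M * ((1 : GLm p m) : Mat p m)))) = 1 ∧
        ∀ a ∈ H₁, ∀ b ∈ H₂, ∀ g ∈ H₃, a * b * g ≠ 1 →
          (∑ M, c M * ZMod.stdAddChar
            (Matrix.trace (M * ((a * b * g : GLm p m) : Mat p m)))) = 0) →
      ¬ budget p m k (2 + ε) <
        ((Nat.card H₁ * Nat.card H₂ * Nat.card H₃ : ℕ) : ℝ) ^ ((2 + ε) / 3) := by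
  have hlog2 : 0 < Real.log 2 := Real.log_pos one_lt_two
  have hlogp : 0 ≤ Real.log p := Real.log_nonneg (by exact_mod_cast hp.out.one_lt.le)
  have hden : 0 < (k : ℝ) ^ 2 * Real.log p + 1 := by positivity
  refine ⟨Real.log 2 / (6 * ((k : ℝ) ^ 2 * Real.log p + 1)), by positivity, ?_⟩
  intro ε hε hε0 m H₁ H₂ H₃ htpp hdes hlt
  have hlaw := witness_law hε htpp hdes hlt
  -- `log 2/(6ε) < k² log p < k² log p + 1` contradicts `ε ≤ ε₀`
  have h1 : Real.log 2 / (6 * ε) < (k : ℝ) ^ 2 * Real.log p + 1 := by linarith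
  have h2 : Real.log 2 < ((k : ℝ) ^ 2 * Real.log p + 1) * (6 * ε) := by
    have := (div_lt_iff₀ (by linarith : (0 : ℝ) < 6 * ε)).mp h1
    linarith
  have h3 : ε * (6 * ((k : ℝ) ^ 2 * Real.log p + 1)) ≤ Real.log 2 := by
    have := (le_div_iff₀ (by positivity : (0 : ℝ) < 6 * ((k : ℝ) ^ 2 * Real.log p + 1))).mp hε0
    linarith
  nlinarith [h2, h3]

end LevelCountLaw
end Summit.MatrixMultiplication.MatrixMultiplication.Theorems.SubgroupIdentityDesigns.Negative
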